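import Summits.CriticalPhenomena.PercolationContinuityZ3.Theses.PercNearOneGluing
import Literature.Probability.Percolation.PercolationProofs
import Literature.Probability.Percolation.ConditionalPositiveAssociationProofs
import Literature.Probability.Percolation.TwoClusterConditionalAssociationProofs
import Summits.CriticalPhenomena.PercolationContinuityZ3.Theorems.PercNearOneGluingAdditiveGluingGoodTwoRelays

/-! TTRL-lite variant V2073 of stmt-CriticalPhenomena-4576 -/

namespace Summit.CriticalPhenomena.PercolationContinuityZ3.Theorems

open MeasureTheory Literature.Probability.LatticeModels Literature.Probability.Percolation
open scoped Classical BigOperators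

/-- **Small-graph case of the penalised good step** (TTRL-lite variant V2073 of `stub_goodStep`,
stmt-CriticalPhenomena-4576; `n ≤ 5`, `A.card ≤ 4`). If `A.card ≤ 3` this is goodness for at most two
relays (`stub_goodStepTwoRelays_k41`, Kozma–Nitzan §3.2, no induction hypothesis needed); if
`A.card = 4` then `A ∪ {o}` already exhausts `Fin n` (`n ≤ 5`), so the non-degeneracy witness
`y ∉ A`, `y ≠ o` cannot exist. The induction hypothesis is not used. -/
theorem stub_goodStep_var2073 :
    ∀ (n : ℕ) (w : Sym2 (Fin n) → unitInterval) (A : Finset (Fin n)) (o b : Fin n), A.card ≤ 4 → n ≤ 5 → b ∈ A → o ∉ A → (∃ y : Fin n, y ∉ A ∧ y ≠ o ∧ (w s(o, y) : ℝ) ≠ 0) → (∀ w' : Sym2 (Fin n) → unitInterval, (Finset.univ.filter (fun v : Fin n => ∃ u : Fin n, 0 < (w' s(u, v) : ℝ))).card < (Finset.univ.filter (fun v : Fin n => ∃ u : Fin n, 0 < (w s(u, v) : ℝ))).card → ∀ (A' : Finset (Fin n)) (o' b' : Fin n), b' ∈ A' → o' ∉ A' → ∀ (t : ℝ) (sel :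 Finset (Fin n) → Fin n), (∀ W, sel W ∈ A') → (∀ a ∈ A', 1 - t ≤ (prodBernoulli w').real (openConn a b')) → (prodBernoulli w').real ((⋃ a ∈ A', openConn o' a) ∩ (openConn o' b')ᶜ) + ∑ W ∈ (Finset.univ : Finset (Finset (Fin n))).filter (fun W => o' ∈ W ∧ Disjoint W A'), (prodBernoulli w').real {ω : BondConfig (Fin n) | openCluster ω o' = (W : Set (Fin n))} * (prodBernoulli w').real (openConnIn ((W : Set (Fin n))ᶜ) (sel W) b')ᶜ ≤ t) → ∀ (t : ℝ) (sel : Finset (Fin n) → Fin n), (∀ W, sel W ∈ A) → (∀ a ∈ A, 1 - t ≤ (prodBernoulli w).real (openConn a b)) → (prodBernoulli w).real ((⋃ a ∈ A, openConn o a) ∩ (openConn o b)ᶜ) + ∑ W ∈ (Finset.univ : Finset (Finset (Fin n))).filter (fun W => o ∈ W ∧ Disjoint W A), (prodBernoulli w).real {ω : BondConfig (Fin n) | openCluster ω o = (W : Set (Fin n))} * (prodBernoulli w).real (openConnIn ((W : Set (Fin n))ᶜ) (sel W) b)ᶜ ≤ t := by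
  intro n w A o b hA hn hbA hoA hy _ih t sel hsel hrel
  rcases Nat.lt_or_ge A.card 4 with hlt | hge
  · exact stub_goodStepTwoRelays_k41 n w A o b hbA hoA (by omega) t sel hsel hrel
  · exfalso
    obtain ⟨y, hyA, hyo, -⟩ := hy
    have hy' : y ∉ insert o A := by
      simp only [Finset.mem_insert, not_or]
      exact ⟨hyo, hyA⟩
    have h1 : (insert y (insert o A)).card = A.card + 2 := by
      rw [Finset.card_insert_of_notMem hy', Finset.card_insert_of_notMem hoA]
    have h2 : (insert y (insert o A)).card ≤ n := by
      simpa using Finset.card_le_univ (insert y (insert o A))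
    omega

end Summit.CriticalPhenomena.PercolationContinuityZ3.Theorems
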